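import Literature.IUT.LogVolume.TensorPacketShellHull
import Literature.IUT.LogVolume.TensorPacketLicenceExact
import Literature.IUT.LogVolume.TensorPacketHullVolume
import HarnessLib

/-!
# The POLYDISC VOLUME GAP on a tensor packet `V = ⊗_{ℚ_p} k_i`: a region confined to a polydisc of radius STRICTLY BELOW a nondegenerate
# translate `g₀·(R_I)^∼` lies in the ONE-𝔪-STEP translate below it, so its hull has `log μ̄` at least `(Σ_j f(L_j)/D)·log p` below
# `log μ̄(g₀·(R_I)^∼)` — in particular below the hull of the container `p^m·log_p(R_I^×)` (Dupuy–Hilado §3.4, §3.7, §4.12;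
# [IUTchIV] Prop. 1.4 (i), (iii))

PROOF-ONLY file (abc-iut cell, Cor. 3.12 sub-crew, seat abc-iut-c312-1, gen 21; offer (π′) «C:VOLUME-FORM CONVERSE», file 1 of 2).  CLASSICAL
`p`-adic algebra on the cell's packet objects (abc-iut-S1 `PacketAlgebra`, abc-iut-c312-3 `dEquiv` / `packetLogμ` / `PacketAdm`, abc-iut-S2
`packetHull` / `polydisc`); EVERY packet (no tameness, any residue degrees, wild factors allowed) unless a theorem says `tame`.  No definition,
no `Prop` fact, no instance, no notation.  TAKES NO SIDE on [IUTchIII] Cor. 3.12.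

SETTING.  `ψ = dEquiv : V ≃ Π_j L_j` the chosen decomposition into `p`-adic fields `L_j = DFac p k j` (ramification index `e_j`, residue degree
`f_j`, `D = Σ_j e_j f_j = packetDegree`); `log μ̄ = packetLogμ` the normalised log-measure (Dupuy–Hilado §3.4, `log μ̄(g·(R_I)^∼) =
Σ_j (e_j f_j/D)·log‖ψ(g)_j‖`, `packetLogμ_smul_normalizedPacket`).  The set statements of the cell's R25–R28 rows («a hull confined to a polydisc
of radius `R′ <` the container's attained radius is NOT the container's hull», `packetHull_ne_of_subset_polydisc_of_lt`) are here made
QUANTITATIVE: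

* §1 `norm_le_mul_rpow_of_norm_lt` — discreteness of `‖·‖` on one `p`-adic field: `‖x‖ < ‖y‖ ⟹ ‖x‖ ≤ ‖y‖·p^{−1/e}` (S1 `norm_le_rpow_of_norm_lt_one`).
* §2 `subset_smul_normalizedPacket_of_forall_norm_dEquiv_le` — `ψ(g·(R_I)^∼)` is the polydisc of radii `‖ψ(g)_j‖`
  (`image_smul_normalizedPacket_eq_hullSet`), so a region is inside `g·(R_I)^∼` iff its `ψ`-coordinates are bounded by those radii;
  **`exists_oneStep_translate`** — for nondegenerate `g₀` there is a nondegenerate `g₁` with `‖ψ(g₁)_j‖ = ‖ψ(g₀)_j‖·p^{−1/e_j}` (a uniformiser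
  of each `L_j`, S1 `exists_norm_eq_rpow_neg`), `{z : ‖ψ(z)_j‖ < ‖ψ(g₀)_j‖ ∀ j} ⊆ g₁·(R_I)^∼`, and
  `log μ̄(g₁·(R_I)^∼) = log μ̄(g₀·(R_I)^∼) − (Σ_j f_j/D)·log p` (the modulus weights `e_j f_j/D` times `log p^{−1/e_j}`).
* §3 **`packetLogμ_packetHull_le_sub_of_forall_norm_dEquiv_lt`** / **`…_of_subset_preimage_polydisc_of_lt`** — if `A ⊆ U` with `A` admissible and
  every `z ∈ U` has `‖ψ(z)_j‖ < ‖ψ(g₀)_j‖` (e.g. `U ⊆ ψ⁻¹ polydisc(R′)`, `R′ < ‖ψ(g₀)_j‖` for all `j`), then `hull(U)` is admissible and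
  **`log μ̄(hull U) ≤ log μ̄(g₀·(R_I)^∼) − (Σ_j f(L_j)/D)·log p`**; the margin is `≥ (log p)/D > 0` (`margin_pos`, `log_div_degree_le_margin`).
* §4 CONTAINER FORM **`packetLogμ_packetHull_le_container_sub_of_subset_preimage_polydisc_of_lt`** — the hull of the container
  `p^m·log_p(R_I^×)` IS the nondegenerate translate `(p^m·⊗_i c_i^out)·(R_I)^∼` for any family `c^out` of elements of largest norm in the
  `log_p(R_i^×)` (abc-iut-c312-5 `packetHull_zpow_smul_logPacket_eq`, abc-iut-w5-d082 `exists_family_isMaxOn_logUnits`), of radius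
  `‖p^m‖·∏_i ‖c_i^out‖` in EVERY factor; so `U ⊆ ψ⁻¹ polydisc(R′)` with `R′ < ‖p^m‖·∏_i ‖c_i^out‖` gives
  `log μ̄(hull U) ≤ log μ̄(packetHull(p^m·log_p(R_I^×))) − (Σ_j f_j/D)·log p`; TAME form (`p > 2`, `e_i ≤ p − 2`: `‖c_i^out‖ = p^{−1/e_i}`,
  `norm_eq_of_isMaxOn_logUnits_of_tame`) **`…_of_tame`** with the radius `‖p^m‖·∏_i p^{−1/e_i}` of R25 (B′) §5 VERBATIM and the container value
  `log μ̄(packetHull(p^m·log_p(R_I^×))) = −(m + Σ_i 1/e_i)·log p` (`packetLogμ_packetHull_zpow_smul_logPacket_of_tame`).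

HONEST SCOPE: classical statements about OUR packet objects and OUR hull functional; nothing here mentions (Ind1)/(Ind2)/(Ind3) or computes a
Θ-region; nothing here asserts that abc is proved or refuted; no side taken on [IUTchIII] Cor. 3.12 / [IUTchIV] Thm. 1.10 or on any author.
[cite: DupuyHilado2025, Def. 3.6.1, §3.4, §3.7, §4.12 p. 16] [cite: Mochizuki2012, IUTchIV Prop. 1.2 (i) p. 10, Prop. 1.4 (i), (iii) pp. 13–14;
IUTchIII Rmk. 3.9.5 (i) p. 127] ([claim: Mochizuki2012, status: disputed] for the IUT quotations) [cite: SerreLocalFields1979, Ch. II §3].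
typed ≠ proved; equal-AS-TYPED ≠ equal in print.
-/

set_option autoImplicit false

noncomputable section

open Set Metric
open scoped Pointwise TensorProduct

namespace Literature.IUT.LogVolume

variable (p : ℕ) [Fact p.Prime]

/-! ## §1 One `p`-adic field: discreteness of the norm -/

section OneField

variable (K : Type*) [NontriviallyNormedField K] [NormedAlgebra ℚ_[p] K] [IsUltrametricDist K] [ProperSpace K]

/-- **Discreteness of `‖·‖` on a `p`-adic field**: `‖x‖ < ‖y‖ ⟹ ‖x‖ ≤ ‖y‖·p^{−1/e}` (the value group is `p^{(1/e)ℤ}`; S1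
`norm_le_rpow_of_norm_lt_one` applied to `x/y`). [cite: SerreLocalFields1979, Ch. II §3] -/
theorem norm_le_mul_rpow_of_norm_lt {x y : K} (h : ‖x‖ < ‖y‖) :
    ‖x‖ ≤ ‖y‖ * (p : ℝ) ^ (-(1 / (absRamificationIdx p K : ℝ))) := by
  have hy0 : 0 < ‖y‖ := (norm_nonneg x).trans_lt h
  have hy : y ≠ 0 := norm_pos_iff.mp hy0
  have h1 : ‖x / y‖ < 1 := by rwa [norm_div, div_lt_one hy0]
  have h2 := norm_le_rpow_of_norm_lt_one p K h1
  rw [norm_div, div_le_iff₀ hy0] at h2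
  linarith [h2]

end OneField

/-! ## §2 The packet: translates as polydiscs, the one-𝔪-step translate -/

section Packet

variable {I : Type} [Fintype I] [DecidableEq I]
variable (k : I → Type) [∀ i, NontriviallyNormedField (k i)] [∀ i, NormedAlgebra ℚ_[p] (k i)]
  [∀ i, IsUltrametricDist (k i)] [∀ i, ProperSpace (k i)]

/-- **A region whose `ψ`-coordinates are bounded by the radii of a nondegenerate translate lies in that translate**:
`(∀ z ∈ U, ∀ j, ‖ψ(z)_j‖ ≤ ‖ψ(g)_j‖) ⟹ U ⊆ g·(R_I)^∼` (`ψ(g·(R_I)^∼) = ∏_j ψ(g)_j·O_{L_j}`, `image_smul_normalizedPacket_eq_hullSet`, and `ψ` is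
injective). [cite: Mochizuki2012, IUTchIV Prop. 1.4 (iii) proof p. 14] [cite: DupuyHilado2025, §4.12 p. 16] -/
theorem subset_smul_normalizedPacket_of_forall_norm_dEquiv_le [Nonempty I] {g : PacketAlgebra p k} (hg : ∀ j, dEquiv p k g j ≠ 0)
    {U : Set (PacketAlgebra p k)} (hU : ∀ z ∈ U, ∀ j, ‖dEquiv p k z j‖ ≤ ‖dEquiv p k g j‖) :
    U ⊆ g • (normalizedPacket p k : Set (PacketAlgebra p k)) := by
  intro z hz
  have hmem : dEquiv p k z ∈ hullSet (DFac p k) (dEquiv p k g) := (mem_polydisc (DFac p k)).mpr (hU z hz)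
  rw [← image_smul_normalizedPacket_eq_hullSet p k (DFac p k) (dEquiv p k) g hg] at hmem
  obtain ⟨z', hz', hzz'⟩ := hmem
  rwa [← (dEquiv p k).injective hzz']

/-- Conversely, the `ψ`-coordinates of the elements of `g·(R_I)^∼` are bounded by `‖ψ(g)_j‖`. [cite: DupuyHilado2025, §4.12 p. 16] -/
theorem norm_dEquiv_le_of_mem_smul_normalizedPacket [Nonempty I] {g : PacketAlgebra p k} (hg : ∀ j, dEquiv p k g j ≠ 0)
    {z : PacketAlgebra p k} (hz : z ∈ g • (normalizedPacket p k : Set (PacketAlgebra p k))) (j : DIdx p k) :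
    ‖dEquiv p k z j‖ ≤ ‖dEquiv p k g j‖ := by
  have hmem : dEquiv p k z ∈ dEquiv p k '' (g • (normalizedPacket p k : Set (PacketAlgebra p k))) := ⟨z, hz, rfl⟩
  rw [image_smul_normalizedPacket_eq_hullSet p k (DFac p k) (dEquiv p k) g hg] at hmem
  exact (mem_polydisc (DFac p k)).mp hmem j

omit [DecidableEq I] [∀ i, IsUltrametricDist (k i)] in
/-- **A family of uniformiser norms along the decomposition**: elements `ϖ_j ∈ L_j` with `‖ϖ_j‖ = p^{−1/e_j}` (S1 `exists_norm_eq_rpow_neg`).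
[cite: SerreLocalFields1979, Ch. II §3] -/
theorem exists_dSum_norm_eq_rpow :
    ∃ ϖ : Π j : DIdx p k, DFac p k j, ∀ j, ‖ϖ j‖ = (p : ℝ) ^ (-(1 / (absRamificationIdx p (DFac p k j) : ℝ))) := by
  have h : ∀ j : DIdx p k, ∃ x : DFac p k j, ‖x‖ = (p : ℝ) ^ (-(1 / (absRamificationIdx p (DFac p k j) : ℝ))) := by
    intro j
    obtain ⟨g, hg⟩ := exists_norm_eq_rpow_neg p (DFac p k j) 1
    refine ⟨(g : DFac p k j), ?_⟩
    rw [hg, Int.cast_one]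
  choose ϖ hϖ using h
  exact ⟨ϖ, hϖ⟩

omit [DecidableEq I] [∀ i, IsUltrametricDist (k i)] in
/-- An admissible region is nonempty (the empty set has measure `0`). [cite: DupuyHilado2025, Def. 3.5.1] -/
theorem nonempty_of_packetAdm {A : Set (PacketAlgebra p k)} (hA : PacketAdm p k A) : A.Nonempty := by
  by_contra h
  rw [Set.not_nonempty_iff_eq_empty] at h
  have h0 : packetVol p k A = 0 := by rw [h, packetVol, Set.image_empty, MeasureTheory.measure_empty]
  exact hA.1.ne' h0

variable [Nonempty I]

omit [DecidableEq I] [∀ i, IsUltrametricDist (k i)] [Nonempty I] in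
/-- The margin rewritten: `Σ_j (1/D)·(e_j f_j)·(−(1/e_j)·log p) = −(Σ_j f_j/D)·log p`. [folklore] -/
private theorem sum_weight_mul_neg_inv_mul_log :
    ∑ j, ((packetDegree p (DFac p k) : ℝ))⁻¹ *
        (((absRamificationIdx p (DFac p k j) : ℝ) * residueDegree p (DFac p k j)) *
          (-(1 / (absRamificationIdx p (DFac p k j) : ℝ)) * Real.log p)) =
      -((∑ j, (residueDegree p (DFac p k j) : ℝ)) / packetDegree p (DFac p k) * Real.log p) := by
  rw [Finset.sum_div, Finset.sum_mul, ← Finset.sum_neg_distrib]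
  refine Finset.sum_congr rfl fun j _ => ?_
  have he : (absRamificationIdx p (DFac p k j) : ℝ) ≠ 0 := by exact_mod_cast (absRamificationIdx_pos p (DFac p k j)).ne'
  field_simp

/-- **THE ONE-𝔪-STEP TRANSLATE.**  For a nondegenerate `g₀ ∈ V` there is a nondegenerate `g₁ ∈ V` with `‖ψ(g₁)_j‖ = ‖ψ(g₀)_j‖·p^{−1/e_j}` at
every factor, containing in its translate `g₁·(R_I)^∼` every `z` with `‖ψ(z)_j‖ < ‖ψ(g₀)_j‖` for all `j` (discreteness, §1), and
`log μ̄(g₁·(R_I)^∼) = log μ̄(g₀·(R_I)^∼) − (Σ_j f(L_j)/D)·log p` (modulus rule, Dupuy–Hilado §3.7 / [IUTchIV] Prop. 1.4 (iii) proof: weights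
`e_j f_j/D`, `log‖ϖ_j‖ = −(1/e_j)·log p`). [cite: DupuyHilado2025, §3.4, §3.7] [cite: Mochizuki2012, IUTchIV Prop. 1.4 (iii) proof p. 14] -/
theorem exists_oneStep_translate (g₀ : PacketAlgebra p k) (hg₀ : ∀ j, dEquiv p k g₀ j ≠ 0) :
    ∃ g₁ : PacketAlgebra p k, (∀ j, dEquiv p k g₁ j ≠ 0) ∧
      (∀ j, ‖dEquiv p k g₁ j‖ = ‖dEquiv p k g₀ j‖ * (p : ℝ) ^ (-(1 / (absRamificationIdx p (DFac p k j) : ℝ)))) ∧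
      {z : PacketAlgebra p k | ∀ j, ‖dEquiv p k z j‖ < ‖dEquiv p k g₀ j‖} ⊆
        g₁ • (normalizedPacket p k : Set (PacketAlgebra p k)) ∧
      packetLogμ p k (g₁ • (normalizedPacket p k : Set (PacketAlgebra p k))) =
        packetLogμ p k (g₀ • (normalizedPacket p k : Set (PacketAlgebra p k))) -
          (∑ j, (residueDegree p (DFac p k j) : ℝ)) / packetDegree p (DFac p k) * Real.log p := by
  have hP : p.Prime := Fact.out
  have hp0 : (0 : ℝ) < p := by exact_mod_cast hP.pos
  obtain ⟨ϖ, hϖ⟩ := exists_dSum_norm_eq_rpow p k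
  have hϖ0 : ∀ j, 0 < ‖ϖ j‖ := fun j => by rw [hϖ j]; positivity
  set g₁ : PacketAlgebra p k := (dEquiv p k).symm (fun j => ϖ j * dEquiv p k g₀ j) with hg₁def
  have hg₁ : ∀ j, dEquiv p k g₁ j = ϖ j * dEquiv p k g₀ j := fun j => by
    rw [hg₁def, AlgEquiv.apply_symm_apply]
  have hnorm : ∀ j, ‖dEquiv p k g₁ j‖ = ‖dEquiv p k g₀ j‖ * (p : ℝ) ^ (-(1 / (absRamificationIdx p (DFac p k j) : ℝ))) :=
    fun j => by rw [hg₁, norm_mul, hϖ, mul_comm]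
  have hne : ∀ j, dEquiv p k g₁ j ≠ 0 := fun j => by
    rw [← norm_pos_iff, hnorm j]
    exact mul_pos (norm_pos_iff.mpr (hg₀ j)) (by positivity)
  refine ⟨g₁, hne, hnorm, ?_, ?_⟩
  · refine subset_smul_normalizedPacket_of_forall_norm_dEquiv_le p k hne fun z hz j => ?_
    rw [hnorm j]
    exact norm_le_mul_rpow_of_norm_lt p (DFac p k j) (hz j)
  · rw [packetLogμ_smul_normalizedPacket p k g₁ hne, packetLogμ_smul_normalizedPacket p k g₀ hg₀, sub_eq_add_neg,
      ← sum_weight_mul_neg_inv_mul_log p k, ← Finset.sum_add_distrib]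
    refine Finset.sum_congr rfl fun j _ => ?_
    rw [hnorm j, Real.log_mul (norm_pos_iff.mpr (hg₀ j)).ne' (by positivity), Real.log_rpow hp0]
    ring

/-! ## §3 The volume gap below a nondegenerate translate -/

/-- **Admissibility**: `A ⊆ U` with `A` admissible and every `ψ`-coordinate of `U` strictly below `‖ψ(g₀)_j‖` ⟹ `hull(U)` is admissible (trapped
between `A` and the one-step translate). [cite: DupuyHilado2025, §4.12 p. 16] -/
theorem packetAdm_packetHull_of_forall_norm_dEquiv_lt (g₀ : PacketAlgebra p k) (hg₀ : ∀ j, dEquiv p k g₀ j ≠ 0)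
    {A U : Set (PacketAlgebra p k)} (hA : PacketAdm p k A) (hAU : A ⊆ U)
    (hU : ∀ z ∈ U, ∀ j, ‖dEquiv p k z j‖ < ‖dEquiv p k g₀ j‖) :
    PacketAdm p k (packetHull p k U) := by
  obtain ⟨g₁, hg₁, -, hsub, -⟩ := exists_oneStep_translate p k g₀ hg₀
  exact packetAdm_packetHull p k hg₁ hA hAU fun z hz => hsub fun j => hU z hz j

/-- **THE VOLUME GAP (coordinate form).**  `A ⊆ U`, `A` admissible, every `z ∈ U` with `‖ψ(z)_j‖ < ‖ψ(g₀)_j‖` at every factor ⟹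
`log μ̄(hull U) ≤ log μ̄(g₀·(R_I)^∼) − (Σ_j f(L_j)/D)·log p`. [cite: DupuyHilado2025, §3.7, §4.12 p. 16]
[cite: Mochizuki2012, IUTchIV Prop. 1.4 (iii) proof p. 14] -/
theorem packetLogμ_packetHull_le_sub_of_forall_norm_dEquiv_lt (g₀ : PacketAlgebra p k) (hg₀ : ∀ j, dEquiv p k g₀ j ≠ 0)
    {A U : Set (PacketAlgebra p k)} (hA : PacketAdm p k A) (hAU : A ⊆ U)
    (hU : ∀ z ∈ U, ∀ j, ‖dEquiv p k z j‖ < ‖dEquiv p k g₀ j‖) :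
    packetLogμ p k (packetHull p k U) ≤
      packetLogμ p k (g₀ • (normalizedPacket p k : Set (PacketAlgebra p k))) -
        (∑ j, (residueDegree p (DFac p k j) : ℝ)) / packetDegree p (DFac p k) * Real.log p := by
  obtain ⟨g₁, hg₁, -, hsub, hvol⟩ := exists_oneStep_translate p k g₀ hg₀
  rw [← hvol]
  exact packetLogμ_packetHull_le_smul_normalizedPacket p k hg₁ hA hAU fun z hz => hsub fun j => hU z hz j

/-- The same for the region itself when it is admissible: `log μ̄(U) ≤ log μ̄(g₀·(R_I)^∼) − (Σ_j f(L_j)/D)·log p`.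
[cite: DupuyHilado2025, §3.7, §4.12 p. 16] -/
theorem packetLogμ_le_sub_of_forall_norm_dEquiv_lt (g₀ : PacketAlgebra p k) (hg₀ : ∀ j, dEquiv p k g₀ j ≠ 0)
    {U : Set (PacketAlgebra p k)} (hUadm : PacketAdm p k U)
    (hU : ∀ z ∈ U, ∀ j, ‖dEquiv p k z j‖ < ‖dEquiv p k g₀ j‖) :
    packetLogμ p k U ≤
      packetLogμ p k (g₀ • (normalizedPacket p k : Set (PacketAlgebra p k))) -
        (∑ j, (residueDegree p (DFac p k j) : ℝ)) / packetDegree p (DFac p k) * Real.log p := by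
  obtain ⟨g₁, hg₁, -, hsub, hvol⟩ := exists_oneStep_translate p k g₀ hg₀
  rw [← hvol]
  exact packetLogμ_mono p k hUadm (packetAdm_smul_normalizedPacket p k g₁ hg₁) fun z hz => hsub fun j => hU z hz j

/-- **THE VOLUME GAP (polydisc form).**  `A ⊆ U ⊆ ψ⁻¹ polydisc(R′)` with `A` admissible and `R′ < ‖ψ(g₀)_j‖` at every factor ⟹ `hull(U)` is
admissible and `log μ̄(hull U) ≤ log μ̄(g₀·(R_I)^∼) − (Σ_j f(L_j)/D)·log p`. [cite: DupuyHilado2025, §3.7, §4.12 p. 16]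
[cite: Mochizuki2012, IUTchIV Prop. 1.4 (iii) proof p. 14] -/
theorem packetLogμ_packetHull_le_sub_of_subset_preimage_polydisc_of_lt (g₀ : PacketAlgebra p k) {R' : ℝ}
    (hR' : ∀ j, R' < ‖dEquiv p k g₀ j‖) {A U : Set (PacketAlgebra p k)} (hA : PacketAdm p k A) (hAU : A ⊆ U)
    (hUR : U ⊆ dEquiv p k ⁻¹' polydisc (DFac p k) (fun _ => R')) :
    PacketAdm p k (packetHull p k U) ∧
      packetLogμ p k (packetHull p k U) ≤
        packetLogμ p k (g₀ • (normalizedPacket p k : Set (PacketAlgebra p k))) -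
          (∑ j, (residueDegree p (DFac p k j) : ℝ)) / packetDegree p (DFac p k) * Real.log p := by
  have hU : ∀ z ∈ U, ∀ j, ‖dEquiv p k z j‖ < ‖dEquiv p k g₀ j‖ := fun z hz j =>
    (((mem_polydisc (DFac p k)).mp (hUR hz)) j).trans_lt (hR' j)
  -- `A` is admissible, hence nonempty; a point of `A ⊆ U` witnesses `0 ≤ ‖ψ(a)_j‖ < ‖ψ(g₀)_j‖`
  obtain ⟨a, ha⟩ := nonempty_of_packetAdm p k hA
  have hg₀ : ∀ j, dEquiv p k g₀ j ≠ 0 := fun j =>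
    norm_pos_iff.mp ((norm_nonneg _).trans_lt (hU a (hAU ha) j))
  exact ⟨packetAdm_packetHull_of_forall_norm_dEquiv_lt p k g₀ hg₀ hA hAU hU,
    packetLogμ_packetHull_le_sub_of_forall_norm_dEquiv_lt p k g₀ hg₀ hA hAU hU⟩

omit [DecidableEq I] [∀ i, IsUltrametricDist (k i)] [Nonempty I] in
/-- **The margin is positive**: `(Σ_j f(L_j)/D)·log p > 0` (`f_j ≥ 1`, `D ≥ 1`: "`p^{f_i}` … the cardinality of the residue field",
"normalized [i.e., by dividing by the degree]"). [cite: Mochizuki2012, IUTchIV Prop. 1.4 (i) p. 13] -/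
theorem margin_pos : 0 < (∑ j, (residueDegree p (DFac p k j) : ℝ)) / packetDegree p (DFac p k) * Real.log p := by
  have hP : p.Prime := Fact.out
  have hlog : 0 < Real.log p := Real.log_pos (by exact_mod_cast hP.one_lt)
  have hD : (0 : ℝ) < packetDegree p (DFac p k) := by exact_mod_cast packetDegree_pos p (DFac p k)
  have hf : (0 : ℝ) < ∑ j, (residueDegree p (DFac p k j) : ℝ) := by
    obtain ⟨j₀⟩ := (inferInstance : Nonempty (DIdx p k))
    have h1 : (0 : ℝ) < residueDegree p (DFac p k j₀) := by exact_mod_cast residueDegree_pos p (DFac p k j₀)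
    exact lt_of_lt_of_le h1 (Finset.single_le_sum (f := fun j => (residueDegree p (DFac p k j) : ℝ))
      (fun j _ => by positivity) (Finset.mem_univ j₀))
  positivity

omit [DecidableEq I] [∀ i, IsUltrametricDist (k i)] [Nonempty I] in
/-- **The margin is at least `(log p)/D`** (every `f_j ≥ 1` and there is a factor); `D = dim_{ℚ_p} V` depends on the packet only
("normalized [i.e., by dividing by the degree]"). [cite: Mochizuki2012, IUTchIV Prop. 1.4 (i) p. 13] -/
theorem log_div_degree_le_margin :
    Real.log p / packetDegree p (DFac p k) ≤ (∑ j, (residueDegree p (DFac p k j) : ℝ)) / packetDegree p (DFac p k) * Real.log p := by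
  have hP : p.Prime := Fact.out
  have hlog : 0 ≤ Real.log p := Real.log_nonneg (by exact_mod_cast hP.one_lt.le)
  have hD : (0 : ℝ) < packetDegree p (DFac p k) := by exact_mod_cast packetDegree_pos p (DFac p k)
  have hf : (1 : ℝ) ≤ ∑ j, (residueDegree p (DFac p k j) : ℝ) := by
    obtain ⟨j₀⟩ := (inferInstance : Nonempty (DIdx p k))
    have h1 : (1 : ℝ) ≤ residueDegree p (DFac p k j₀) := by exact_mod_cast residueDegree_pos p (DFac p k j₀)
    exact h1.trans (Finset.single_le_sum (f := fun j => (residueDegree p (DFac p k j) : ℝ))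
      (fun j _ => by positivity) (Finset.mem_univ j₀))
  rw [div_mul_eq_mul_div, div_le_div_iff_of_pos_right hD]
  nlinarith

/-! ## §4 The volume gap below the CONTAINER `packetHull(p^m·log_p(R_I^×))` -/

omit [∀ i, IsUltrametricDist (k i)] [Nonempty I] in
/-- The radius of the container translate: `‖ψ(p^m·⊗_i c_i)_j‖ = ‖p^m‖·∏_i ‖c_i‖` at EVERY factor `j` (the component embeddings are isometries;
twin of abc-iut-c312-5's `norm_dEquiv_ppow_mul_purePacket` in `Summits/`, which a Literature file cannot import). [cite: DupuyHilado2025, §3.7] [cite: Mochizuki2012, IUTchIV Prop. 1.4 (i) p. 13] -/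
private theorem norm_dEquiv_ppow_mul_purePacket_apply (m : ℤ) (c : Π i, k i) (j : DIdx p k) :
    ‖dEquiv p k (ppow p k m * purePacket p k c) j‖ = ‖(p : ℚ_[p]) ^ m‖ * ∏ i, ‖c i‖ := by
  rw [map_mul, Pi.mul_apply, norm_mul, norm_psi_ppow_apply p k (DFac p k) (dEquiv p k) m j, Padic.norm_p_zpow,
    psi_purePacket_apply p k (DFac p k) (dEquiv p k) c j, norm_prod]
  congr 1
  exact Finset.prod_congr rfl fun i _ => norm_factorEmb p k (DFac p k) (dEquiv p k) i j (c i)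

/-- **THE VOLUME GAP BELOW THE CONTAINER (every packet).**  Let `c^out` be a family of elements of largest norm in the `log_p(R_i^×)`; if
`A ⊆ U ⊆ ψ⁻¹ polydisc(R′)` with `A` admissible and `R′ < ‖p^m‖·∏_i ‖c_i^out‖`, then `hull(U)` is admissible and
**`log μ̄(hull U) ≤ log μ̄(packetHull(p^m·log_p(R_I^×))) − (Σ_j f(L_j)/D)·log p`** (the container hull is the nondegenerate translate
`(p^m·⊗c^out)·(R_I)^∼`, `packetHull_zpow_smul_logPacket_eq`). [cite: DupuyHilado2025, §4.9, §4.12 p. 16]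
[cite: Mochizuki2012, IUTchIV Prop. 1.2 (i) p. 10, Prop. 1.4 (iii) p. 13] -/
theorem packetLogμ_packetHull_le_container_sub_of_subset_preimage_polydisc_of_lt (m : ℤ) {c : Π i, k i}
    (hcΛ : ∀ i, c i ∈ logUnits (k i)) (hdom : ∀ i, ∀ w ∈ logUnits (k i), ‖w‖ ≤ ‖c i‖) {R' : ℝ}
    (hR' : R' < ‖(p : ℚ_[p]) ^ m‖ * ∏ i, ‖c i‖) {A U : Set (PacketAlgebra p k)} (hA : PacketAdm p k A) (hAU : A ⊆ U)
    (hUR : U ⊆ dEquiv p k ⁻¹' polydisc (DFac p k) (fun _ => R')) :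
    PacketAdm p k (packetHull p k U) ∧
      packetLogμ p k (packetHull p k U) ≤
        packetLogμ p k (packetHull p k (((p : ℚ_[p]) ^ m) • (logPacket p k : Set (PacketAlgebra p k)))) -
          (∑ j, (residueDegree p (DFac p k j) : ℝ)) / packetDegree p (DFac p k) * Real.log p := by
  have hc0 : ∀ i, c i ≠ 0 := fun i => ne_zero_of_isMaxOn_logUnits p (k i) (hdom i)
  rw [packetHull_zpow_smul_logPacket_eq p k hc0 hcΛ hdom m]
  refine packetLogμ_packetHull_le_sub_of_subset_preimage_polydisc_of_lt p k _ (fun j => ?_) hA hAU hUR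
  rwa [norm_dEquiv_ppow_mul_purePacket_apply p k m c j]

/-- **Container value at a TAME packet**: `log μ̄(packetHull(p^m·log_p(R_I^×))) = −m·log p − (Σ_i 1/e_i)·log p` (`p > 2`, every `e_i ≤ p − 2`).
[cite: Mochizuki2012, IUTchIV Prop. 1.2 (i) p. 10, Prop. 1.4 (iii) p. 13] [cite: DupuyHilado2025, §4.12] -/
theorem packetLogμ_packetHull_zpow_smul_logPacket_of_tame (hp : 2 < p) (he : ∀ i, absRamificationIdx p (k i) ≤ p - 2) (m : ℤ) :
    packetLogμ p k (packetHull p k (((p : ℚ_[p]) ^ m) • (logPacket p k : Set (PacketAlgebra p k)))) =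
      -(m * Real.log p) + -(∑ i, 1 / (absRamificationIdx p (k i) : ℝ)) * Real.log p := by
  rw [packetLogμ_packetHull_zpow_smul_logPacket p k m, packetLogμ_packetHull_logPacket_eq_of_tame p k hp he]

/-- **THE VOLUME GAP BELOW THE CONTAINER AT A TAME PACKET** (`p > 2`, every `e_i ≤ p − 2`; any residue degrees): `A ⊆ U ⊆ ψ⁻¹ polydisc(R′)`, `A`
admissible, `R′ < ‖p^m‖·∏_i p^{−1/e_i}` (R25 (B′) §5's radius VERBATIM) ⟹ `hull(U)` is admissible and
**`log μ̄(hull U) ≤ log μ̄(packetHull(p^m·log_p(R_I^×))) − (Σ_j f(L_j)/D)·log p = −(m + Σ_i 1/e_i)·log p − (Σ_j f(L_j)/D)·log p`** — the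
set statement «`hull U ≠ packetHull(p^m·log_p(R_I^×))`» made a log-volume gap. [cite: DupuyHilado2025, §4.9, §4.12 p. 16]
[cite: Mochizuki2012, IUTchIV Prop. 1.2 (i) p. 10, Prop. 1.4 (iii) p. 13] -/
theorem packetLogμ_packetHull_le_container_sub_of_subset_preimage_polydisc_of_lt_of_tame (hp : 2 < p)
    (he : ∀ i, absRamificationIdx p (k i) ≤ p - 2) (m : ℤ) {R' : ℝ}
    (hR' : R' < ‖(p : ℚ_[p]) ^ m‖ * ∏ i, (p : ℝ) ^ (-(1 / (absRamificationIdx p (k i) : ℝ))))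
    {A U : Set (PacketAlgebra p k)} (hA : PacketAdm p k A) (hAU : A ⊆ U)
    (hUR : U ⊆ dEquiv p k ⁻¹' polydisc (DFac p k) (fun _ => R')) :
    PacketAdm p k (packetHull p k U) ∧
      packetLogμ p k (packetHull p k U) ≤
        packetLogμ p k (packetHull p k (((p : ℚ_[p]) ^ m) • (logPacket p k : Set (PacketAlgebra p k)))) -
          (∑ j, (residueDegree p (DFac p k j) : ℝ)) / packetDegree p (DFac p k) * Real.log p ∧
      packetLogμ p k (packetHull p k U) ≤
        -(m * Real.log p) + -(∑ i, 1 / (absRamificationIdx p (k i) : ℝ)) * Real.log p -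
          (∑ j, (residueDegree p (DFac p k j) : ℝ)) / packetDegree p (DFac p k) * Real.log p := by
  obtain ⟨c, hcΛ, hdom⟩ := exists_family_isMaxOn_logUnits p k
  have hprod : ∏ i, ‖c i‖ = ∏ i, (p : ℝ) ^ (-(1 / (absRamificationIdx p (k i) : ℝ))) :=
    Finset.prod_congr rfl fun i _ => norm_eq_of_isMaxOn_logUnits_of_tame p (k i) hp (he i) (hcΛ i) (hdom i)
  rw [← hprod] at hR'
  obtain ⟨hadm, hle⟩ := packetLogμ_packetHull_le_container_sub_of_subset_preimage_polydisc_of_lt p k m hcΛ hdom hR' hA hAU hUR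
  refine ⟨hadm, hle, ?_⟩
  rwa [packetLogμ_packetHull_zpow_smul_logPacket_of_tame p k hp he m] at hle

end Packet

end Literature.IUT.LogVolume

end
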